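import Mathlib
import Literature.MathematicalPhysics.MHD.BallooningSAlpha
import Summits.Ventures.FusionMHD.Models.SAlphaRiccatiEnergy
import HarnessLib

/-!
# «F3.BALLOON-sα-STABLE-TAIL»: the far-field Riccati supersolution of the `s–α` model at `(s, α) = (1, 2/5)` — `f₂ = 1 − 1/θ + (2/5)cos θ/θ² + ((8/5) sin θ + (2/25) sin θ cos θ − (2/5) cos θ)/θ³` has residual `≤ 0` for EVERY `θ ≥ 10`, with explicit constants (no `O(·)`)

LADDER-GRIDFUSION rung F3 (cell `gridfusion`; lead g12 RULING 9ey (2): «REQUIRED … the remainder's sign PROVED for all θ ≥ T with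
explicit constants»; this is the Stage-B tail of the STABLE-POINT programme, companion of `SAlphaStableWindow` (#199, the window
`[−2π, 2π]`) and of the engine `SAlphaRiccatiEnergy`).  Statements + proofs by gridfusion-model-7 g8, 2026-08-28.  0 kit, 0 named
facts, no `decide`.

## What is PROVED
With `Λ = θ − (2/5) sin θ`, `Λ′ = 1 − (2/5) cos θ`, `p = 1 + Λ²` and the ansatz `u = f₂·p^{-1/2}` (lead's check 9ey (2):
`L(p^{-1/2} f) = p^{-1/2}[p f″ + (α cos θ − Λ′²/p) f]`), the tail factor
`f₂(θ) = 1 − δ/θ + α cos θ/θ² + (4α sin θ + (α²/2) sin θ cos θ − αδ cos θ)/θ³` at `δ = 1`, `α = 2/5` — the three `θ⁻³` harmonics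
are exactly those that cancel the oscillatory `θ¹`-terms of `E₂ := p² f₂″ + f₂(α p cos θ − Λ′²)`, leaving `E₂ = −2δθ + O(1)`:
* `tail_identity`: `θ⁵·E₂ = −2θ⁶ + Σ_{j ≤ 5} m_j(sin θ, cos θ) θ^j` with the six trigonometric polynomials `m_j` EXPLICIT (pure
  algebra after clearing `θ⁻¹ … θ⁻⁵`; formal derivatives `sin′ = cos`, `cos′ = −sin`, no Pythagoras);
* `m_j ≤ M_j` from `|sin|, |cos| ≤ 1` with `M₅ = 1259/125`, `M₄ = 27753/625`, `M₃ = 205424/3125`, `M₂ = 1448308/15625`, `M₁ = 926064/15625`,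
  `M₀ = 524784/15625` (sums of absolute values of the coefficients);
* `E2_nonpos`: `E₂(θ) ≤ 0` for every `θ ≥ 10` (since `2θ ≥ 20 > Σ M_j 10^{j−5} ≈ 15.3`);
* `f2_pos`: `f₂ > 0` for `θ ≥ 10`; `riccati_tail_eq`: for the log-derivative field `w₂ = f₂′/f₂ − ΛΛ′/p` the Riccati residual of
  `SAlphaRiccati` is `E₂/(p f₂)`, hence `riccati_tail_nonpos`: `Ric(w₂) ≤ 0` on `[10, ∞)`.
What this is NOT: not yet the full-line stability statement — that needs an inner field on `[0, T]`, `T ≥ 10`, whose log-derivative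
at `T` is `≥ f₂′(T)/f₂(T)` (≈ 0.007 at `4π`; the window certificate's `1 − 11θ²/500` decreases and does not glue), e.g. a
Taylor-model-certified polynomial factor or certnum's RQ-022 enclosure of the even solution; the junction and the evenness are then
one application of `SAlphaRiccati.energy_nonneg_of_riccati` per piece.

THREE COLUMNS.  CERTIFIED: the four kernel facts above about the `s–α` MODEL's one-surface operator at `(1, 2/5)`.  VALIDATED: the true
`E₂` is already `≤ −7` on `[4, 11]` (float); the crude constants put the threshold at `θ ≈ 9`.  MODELLED: `s–α` model (Freidberg
(12.96)–(12.99)); nothing about a device.  Citations: Freidberg 2014 §12.6.2 (12.97) [Freidberg2014]; Hartman 2002 Ch. XI Thm. 6.2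
[Hartman2002].  Everything below is [instance data].
-/

noncomputable section

open Real Set
open Literature.MathematicalPhysics.MHD.Ballooning

namespace Summit.Ventures.FusionMHD.Models

namespace SAlphaStableTail

/-! ### §1 The tail factor and its first two derivatives (formal) -/

/-- `f₂ = 1 − 1/θ + (2/5)cos θ/θ² + ((8/5)sin θ + (2/25)sin θ cos θ − (2/5)cos θ)/θ³`. [instance data] -/
def f2 (θ : ℝ) : ℝ :=
  1 - 1 / θ + 2 / 5 * Real.cos θ / θ ^ 2
    + (8 / 5 * Real.sin θ + 2 / 25 * Real.sin θ * Real.cos θ - 2 / 5 * Real.cos θ) / θ ^ 3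

/-- `f₂′` (explicit). [instance data] -/
def f2' (θ : ℝ) : ℝ :=
  1 / θ ^ 2 + 2 / 5 * (-Real.sin θ * θ ^ 2 - Real.cos θ * (2 * θ)) / θ ^ 4
    + ((8 / 5 * Real.cos θ + 2 / 25 * (Real.cos θ * Real.cos θ - Real.sin θ * Real.sin θ) + 2 / 5 * Real.sin θ) * θ ^ 3
        - (8 / 5 * Real.sin θ + 2 / 25 * Real.sin θ * Real.cos θ - 2 / 5 * Real.cos θ) * (3 * θ ^ 2)) / θ ^ 6

/-- `f₂″` (explicit Laurent form, formal derivative of `f₂′`). [instance data] -/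
def f2'' (θ : ℝ) : ℝ :=
  -(24 / 5 : ℝ) * Real.cos θ / θ ^ 5 + (96 / 5 : ℝ) * Real.sin θ / θ ^ 5
    + (24 / 25 : ℝ) * (Real.sin θ * Real.cos θ) / θ ^ 5 + -(36 / 5 : ℝ) * Real.cos θ / θ ^ 4
    + -(12 / 25 : ℝ) * Real.cos θ ^ 2 / θ ^ 4 + -(12 / 5 : ℝ) * Real.sin θ / θ ^ 4 + (12 / 25 : ℝ) * Real.sin θ ^ 2 / θ ^ 4
    + -(2 : ℝ) / θ ^ 3 + (2 / 5 : ℝ) * Real.cos θ / θ ^ 3 + -(8 / 25 : ℝ) * (Real.sin θ * Real.cos θ) / θ ^ 3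
    + -(2 / 5 : ℝ) * Real.cos θ / θ ^ 2

/-- `f₂′` is the derivative of `f₂` (`θ ≠ 0`). [instance data] -/
theorem hasDerivAt_f2 {θ : ℝ} (hθ : θ ≠ 0) : HasDerivAt f2 (f2' θ) θ := by
  have hS := Real.hasDerivAt_sin θ
  have hC := Real.hasDerivAt_cos θ
  have hid := hasDerivAt_id' θ
  have h2 : HasDerivAt (fun θ : ℝ => θ ^ 2) (2 * θ) θ := by simpa using hasDerivAt_pow 2 θ
  have h3 : HasDerivAt (fun θ : ℝ => θ ^ 3) (3 * θ ^ 2) θ := by simpa using hasDerivAt_pow 3 θ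
  have hθ2 : θ ^ 2 ≠ 0 := pow_ne_zero 2 hθ
  have hθ3 : θ ^ 3 ≠ 0 := pow_ne_zero 3 hθ
  unfold f2
  have hA := (hasDerivAt_const θ (1:ℝ)).sub ((hasDerivAt_const θ (1:ℝ)).div hid hθ)
  have hB := ((hC.const_mul (2 / 5 : ℝ)).div h2 hθ2)
  have hN := ((hS.const_mul (8 / 5 : ℝ)).add ((hS.const_mul (2 / 25 : ℝ)).mul hC)).sub (hC.const_mul (2 / 5 : ℝ))
  have hD := hN.div h3 hθ3
  have h := (hA.add hB).add hD
  refine h.congr_deriv ?_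
  unfold f2'
  norm_num only [Pi.add_apply, Pi.sub_apply, Pi.mul_apply, Pi.div_apply, Pi.neg_apply]
  field_simp
  ring

/-- `f₂″` is the derivative of `f₂′` (`θ ≠ 0`). [instance data] -/
theorem hasDerivAt_f2' {θ : ℝ} (hθ : θ ≠ 0) : HasDerivAt f2' (f2'' θ) θ := by
  have hS := Real.hasDerivAt_sin θ
  have hC := Real.hasDerivAt_cos θ
  have hid := hasDerivAt_id' θ
  have h2 : HasDerivAt (fun θ : ℝ => θ ^ 2) (2 * θ) θ := by simpa using hasDerivAt_pow 2 θ
  have h3 : HasDerivAt (fun θ : ℝ => θ ^ 3) (3 * θ ^ 2) θ := by simpa using hasDerivAt_pow 3 θ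
  have h4 : HasDerivAt (fun θ : ℝ => θ ^ 4) (4 * θ ^ 3) θ := by simpa using hasDerivAt_pow 4 θ
  have h6 : HasDerivAt (fun θ : ℝ => θ ^ 6) (6 * θ ^ 5) θ := by simpa using hasDerivAt_pow 6 θ
  have hθ2 : θ ^ 2 ≠ 0 := pow_ne_zero 2 hθ
  have hθ4 : θ ^ 4 ≠ 0 := pow_ne_zero 4 hθ
  have hθ6 : θ ^ 6 ≠ 0 := pow_ne_zero 6 hθ
  unfold f2'
  have hA := (hasDerivAt_const θ (1:ℝ)).div h2 hθ2
  have hBn := ((hS.neg.mul h2).sub (hC.mul (hid.const_mul (2:ℝ))))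
  have hB := (hBn.const_mul (2 / 5 : ℝ)).div h4 hθ4
  have hN1 := ((hC.const_mul (8 / 5 : ℝ)).add (((hC.mul hC).sub (hS.mul hS)).const_mul (2 / 25 : ℝ))).add (hS.const_mul (2 / 5 : ℝ))
  have hN2 := ((hS.const_mul (8 / 5 : ℝ)).add ((hS.const_mul (2 / 25 : ℝ)).mul hC)).sub (hC.const_mul (2 / 5 : ℝ))
  have hNum := (hN1.mul h3).sub (hN2.mul (h2.const_mul (3:ℝ)))
  have hD := hNum.div h6 hθ6
  have h := (hA.add hB).add hD
  refine h.congr_deriv ?_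
  unfold f2''
  norm_num only [Pi.add_apply, Pi.sub_apply, Pi.mul_apply, Pi.div_apply, Pi.neg_apply]
  field_simp
  ring

/-! ### §2 The residual `E₂ = p² f₂″ + f₂ (α p cos θ − Λ′²)` and its sign for `θ ≥ 10` -/

/-- `E₂ = p² f₂″ + f₂((2/5) p cos θ − Λ′²)`, `p = 1 + Λ²`. [instance data] -/
def E2 (θ : ℝ) : ℝ :=
  SAlpha.bending 1 (2 / 5) θ ^ 2 * f2'' θ
    + f2 θ * (2 / 5 * SAlpha.bending 1 (2 / 5) θ * Real.cos θ - SAlpha.localShear 1 (2 / 5) θ ^ 2)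

/-- The trigonometric polynomial `m0` (coefficient of `θ^0` in `θ⁵E₂`). [instance data] -/
def m0 (θ : ℝ) : ℝ :=
  -(24 / 5 : ℝ) * Real.cos θ + (96 / 5 : ℝ) * Real.sin θ + (24 / 25 : ℝ) * Real.sin θ * Real.cos θ + -(192 / 125 : ℝ) * Real.sin θ ^ 2 * Real.cos θ + (768 / 125 : ℝ) * Real.sin θ ^ 3 + (192 / 625 : ℝ) * Real.sin θ ^ 3 * Real.cos θ + -(384 / 3125 : ℝ) * Real.sin θ ^ 4 * Real.cos θ + (1536 / 3125 : ℝ) * Real.sin θ ^ 5 + (384 / 15625 : ℝ) * Real.sin θ ^ 5 * Real.cos θ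

/-- The trigonometric polynomial `m1` (coefficient of `θ^1` in `θ⁵E₂`). [instance data] -/
def m1 (θ : ℝ) : ℝ :=
  -(36 / 5 : ℝ) * Real.cos θ + -(12 / 25 : ℝ) * Real.cos θ ^ 2 + -(12 / 5 : ℝ) * Real.sin θ + (192 / 25 : ℝ) * Real.sin θ * Real.cos θ + -(756 / 25 : ℝ) * Real.sin θ ^ 2 + -(96 / 25 : ℝ) * Real.sin θ ^ 2 * Real.cos θ + -(96 / 625 : ℝ) * Real.sin θ ^ 2 * Real.cos θ ^ 2 + -(96 / 125 : ℝ) * Real.sin θ ^ 3 + (768 / 625 : ℝ) * Real.sin θ ^ 3 * Real.cos θ + -(2976 / 625 : ℝ) * Real.sin θ ^ 4 + -(1344 / 3125 : ℝ) * Real.sin θ ^ 4 * Real.cos θ + -(192 / 15625 : ℝ) * Real.sin θ ^ 4 * Real.cos θ ^ 2 + -(192 / 3125 : ℝ) * Real.sin θ ^ 5 + (192 / 15625 : ℝ) * Real.sin θ ^ 6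

/-- The trigonometric polynomial `m2` (coefficient of `θ^2` in `θ⁵E₂`). [instance data] -/
def m2 (θ : ℝ) : ℝ :=
  -(2 : ℝ) + -(44 / 5 : ℝ) * Real.cos θ + -(12 / 25 : ℝ) * Real.cos θ ^ 2 + (8 / 125 : ℝ) * Real.cos θ ^ 3 + (184 / 5 : ℝ) * Real.sin θ + (374 / 25 : ℝ) * Real.sin θ * Real.cos θ + (76 / 125 : ℝ) * Real.sin θ * Real.cos θ ^ 2 + -(8 / 625 : ℝ) * Real.sin θ * Real.cos θ ^ 3 + (16 / 5 : ℝ) * Real.sin θ ^ 2 + -(112 / 25 : ℝ) * Real.sin θ ^ 2 * Real.cos θ + -(16 / 625 : ℝ) * Real.sin θ ^ 2 * Real.cos θ ^ 2 + (2208 / 125 : ℝ) * Real.sin θ ^ 3 + (1728 / 625 : ℝ) * Real.sin θ ^ 3 * Real.cos θ + (16 / 125 : ℝ) * Real.sin θ ^ 3 * Real.cos θ ^ 2 + (352 / 625 : ℝ) * Real.sin θ ^ 4 + (32 / 3125 : ℝ) * Real.sin θ ^ 4 * Real.cos θ + -(384 / 3125 : ℝ) * Real.sin θ ^ 5 + -(128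 / 15625 : ℝ) * Real.sin θ ^ 5 * Real.cos θ

/-- The trigonometric polynomial `m3` (coefficient of `θ^3` in `θ⁵E₂`). [instance data] -/
def m3 (θ : ℝ) : ℝ :=
  -(76 / 5 : ℝ) * Real.cos θ + -(12 / 25 : ℝ) * Real.cos θ ^ 2 + -(8 / 125 : ℝ) * Real.cos θ ^ 3 + -(8 / 5 : ℝ) * Real.sin θ + (176 / 25 : ℝ) * Real.sin θ * Real.cos θ + (16 / 125 : ℝ) * Real.sin θ * Real.cos θ ^ 2 + -(744 / 25 : ℝ) * Real.sin θ ^ 2 + -(1072 / 125 : ℝ) * Real.sin θ ^ 2 * Real.cos θ + -(288 / 625 : ℝ) * Real.sin θ ^ 2 * Real.cos θ ^ 2 + -(224 / 125 : ℝ) * Real.sin θ ^ 3 + -(64 / 625 : ℝ) * Real.sin θ ^ 3 * Real.cos θ + (288 / 625 : ℝ) * Real.sin θ ^ 4 + (224 / 3125 : ℝ) * Real.sin θ ^ 4 * Real.cos θ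

/-- The trigonometric polynomial `m4` (coefficient of `θ^4` in `θ⁵E₂`). [instance data] -/
def m4 (θ : ℝ) : ℝ :=
  -(3 : ℝ) + -(26 / 5 : ℝ) * Real.cos θ + (96 / 5 : ℝ) * Real.sin θ + (328 / 25 : ℝ) * Real.sin θ * Real.cos θ + (84 / 125 : ℝ) * Real.sin θ * Real.cos θ ^ 2 + (48 / 25 : ℝ) * Real.sin θ ^ 2 + (8 / 25 : ℝ) * Real.sin θ ^ 2 * Real.cos θ + -(96 / 125 : ℝ) * Real.sin θ ^ 3 + -(128 / 625 : ℝ) * Real.sin θ ^ 3 * Real.cos θ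

/-- The trigonometric polynomial `m5` (coefficient of `θ^5` in `θ⁵E₂`). [instance data] -/
def m5 (θ : ℝ) : ℝ :=
  -(1 : ℝ) + -(34 / 5 : ℝ) * Real.cos θ + -(12 / 25 : ℝ) * Real.cos θ ^ 2 + (4 / 5 : ℝ) * Real.sin θ + -(8 / 25 : ℝ) * Real.sin θ * Real.cos θ + (12 / 25 : ℝ) * Real.sin θ ^ 2 + (24 / 125 : ℝ) * Real.sin θ ^ 2 * Real.cos θ

/-- THE TAIL IDENTITY `θ⁵·E₂ = −2θ⁶ + m₅θ⁵ + m₄θ⁴ + m₃θ³ + m₂θ² + m₁θ + m₀` (pure algebra; `θ ≠ 0`). [instance data] -/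
theorem tail_identity {θ : ℝ} (hθ : θ ≠ 0) :
    θ ^ 5 * E2 θ = -2 * θ ^ 6 + m5 θ * θ ^ 5 + m4 θ * θ ^ 4 + m3 θ * θ ^ 3 + m2 θ * θ ^ 2 + m1 θ * θ + m0 θ := by
  unfold E2 f2 f2'' m0 m1 m2 m3 m4 m5 SAlpha.bending SAlpha.shearParam SAlpha.localShear
  field_simp
  ring

/-- `v·m ≤ |v|` whenever `|m| ≤ 1` (used termwise with `m` a product of powers of `sin θ`, `cos θ`). [instance data] -/
theorem coef_mul_le {v m : ℝ} (hm : |m| ≤ 1) : v * m ≤ |v| := by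
  have h1 : v * m ≤ |v * m| := le_abs_self _
  rw [abs_mul] at h1
  nlinarith [abs_nonneg v]

/-- `|sin θ ^ a · cos θ ^ b| ≤ 1`. [instance data] -/
theorem abs_sin_pow_mul_cos_pow_le (θ : ℝ) (a b : ℕ) : |Real.sin θ ^ a * Real.cos θ ^ b| ≤ 1 := by
  rw [abs_mul, abs_pow, abs_pow]
  have h1 : |Real.sin θ| ^ a ≤ 1 := pow_le_one₀ (abs_nonneg _) (Real.abs_sin_le_one θ)
  have h2 : |Real.cos θ| ^ b ≤ 1 := pow_le_one₀ (abs_nonneg _) (Real.abs_cos_le_one θ)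
  nlinarith [pow_nonneg (abs_nonneg (Real.sin θ)) a, pow_nonneg (abs_nonneg (Real.cos θ)) b]

/-- `m0 ≤ 524784/15625` (sum of the absolute values of its coefficients). [instance data] -/
theorem m0_le (θ : ℝ) : m0 θ ≤ (524784 / 15625 : ℝ) := by
  have u0 := abs_le.1 (by simpa using abs_sin_pow_mul_cos_pow_le θ 0 1 : |Real.cos θ| ≤ 1)
  have u1 := abs_le.1 (by simpa using abs_sin_pow_mul_cos_pow_le θ 1 0 : |Real.sin θ| ≤ 1)
  have u2 := abs_le.1 (by simpa using abs_sin_pow_mul_cos_pow_le θ 1 1 : |Real.sin θ * Real.cos θ| ≤ 1)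
  have u3 := abs_le.1 (by simpa using abs_sin_pow_mul_cos_pow_le θ 2 1 : |Real.sin θ ^ 2 * Real.cos θ| ≤ 1)
  have u4 := abs_le.1 (by simpa using abs_sin_pow_mul_cos_pow_le θ 3 0 : |Real.sin θ ^ 3| ≤ 1)
  have u5 := abs_le.1 (by simpa using abs_sin_pow_mul_cos_pow_le θ 3 1 : |Real.sin θ ^ 3 * Real.cos θ| ≤ 1)
  have u6 := abs_le.1 (by simpa using abs_sin_pow_mul_cos_pow_le θ 4 1 : |Real.sin θ ^ 4 * Real.cos θ| ≤ 1)
  have u7 := abs_le.1 (by simpa using abs_sin_pow_mul_cos_pow_le θ 5 0 : |Real.sin θ ^ 5| ≤ 1)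
  have u8 := abs_le.1 (by simpa using abs_sin_pow_mul_cos_pow_le θ 5 1 : |Real.sin θ ^ 5 * Real.cos θ| ≤ 1)
  unfold m0
  linarith [u0.1, u0.2, u1.1, u1.2, u2.1, u2.2, u3.1, u3.2, u4.1, u4.2, u5.1, u5.2, u6.1, u6.2, u7.1, u7.2, u8.1, u8.2]

/-- `m1 ≤ 926064/15625` (sum of the absolute values of its coefficients). [instance data] -/
theorem m1_le (θ : ℝ) : m1 θ ≤ (926064 / 15625 : ℝ) := by
  have u0 := abs_le.1 (by simpa using abs_sin_pow_mul_cos_pow_le θ 0 1 : |Real.cos θ| ≤ 1)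
  have u1 := abs_le.1 (by simpa using abs_sin_pow_mul_cos_pow_le θ 0 2 : |Real.cos θ ^ 2| ≤ 1)
  have u2 := abs_le.1 (by simpa using abs_sin_pow_mul_cos_pow_le θ 1 0 : |Real.sin θ| ≤ 1)
  have u3 := abs_le.1 (by simpa using abs_sin_pow_mul_cos_pow_le θ 1 1 : |Real.sin θ * Real.cos θ| ≤ 1)
  have u4 := abs_le.1 (by simpa using abs_sin_pow_mul_cos_pow_le θ 2 0 : |Real.sin θ ^ 2| ≤ 1)
  have u5 := abs_le.1 (by simpa using abs_sin_pow_mul_cos_pow_le θ 2 1 : |Real.sin θ ^ 2 * Real.cos θ| ≤ 1)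
  have u6 := abs_le.1 (by simpa using abs_sin_pow_mul_cos_pow_le θ 2 2 : |Real.sin θ ^ 2 * Real.cos θ ^ 2| ≤ 1)
  have u7 := abs_le.1 (by simpa using abs_sin_pow_mul_cos_pow_le θ 3 0 : |Real.sin θ ^ 3| ≤ 1)
  have u8 := abs_le.1 (by simpa using abs_sin_pow_mul_cos_pow_le θ 3 1 : |Real.sin θ ^ 3 * Real.cos θ| ≤ 1)
  have u9 := abs_le.1 (by simpa using abs_sin_pow_mul_cos_pow_le θ 4 0 : |Real.sin θ ^ 4| ≤ 1)
  have u10 := abs_le.1 (by simpa using abs_sin_pow_mul_cos_pow_le θ 4 1 : |Real.sin θ ^ 4 * Real.cos θ| ≤ 1)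
  have u11 := abs_le.1 (by simpa using abs_sin_pow_mul_cos_pow_le θ 4 2 : |Real.sin θ ^ 4 * Real.cos θ ^ 2| ≤ 1)
  have u12 := abs_le.1 (by simpa using abs_sin_pow_mul_cos_pow_le θ 5 0 : |Real.sin θ ^ 5| ≤ 1)
  have u13 := abs_le.1 (by simpa using abs_sin_pow_mul_cos_pow_le θ 6 0 : |Real.sin θ ^ 6| ≤ 1)
  unfold m1
  linarith [u0.1, u0.2, u1.1, u1.2, u2.1, u2.2, u3.1, u3.2, u4.1, u4.2, u5.1, u5.2, u6.1, u6.2, u7.1, u7.2, u8.1, u8.2, u9.1, u9.2, u10.1, u10.2, u11.1, u11.2, u12.1, u12.2, u13.1, u13.2]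

/-- `m2 ≤ 1448308/15625` (sum of the absolute values of its coefficients). [instance data] -/
theorem m2_le (θ : ℝ) : m2 θ ≤ (1448308 / 15625 : ℝ) := by
  have u1 := abs_le.1 (by simpa using abs_sin_pow_mul_cos_pow_le θ 0 1 : |Real.cos θ| ≤ 1)
  have u2 := abs_le.1 (by simpa using abs_sin_pow_mul_cos_pow_le θ 0 2 : |Real.cos θ ^ 2| ≤ 1)
  have u3 := abs_le.1 (by simpa using abs_sin_pow_mul_cos_pow_le θ 0 3 : |Real.cos θ ^ 3| ≤ 1)
  have u4 := abs_le.1 (by simpa using abs_sin_pow_mul_cos_pow_le θ 1 0 : |Real.sin θ| ≤ 1)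
  have u5 := abs_le.1 (by simpa using abs_sin_pow_mul_cos_pow_le θ 1 1 : |Real.sin θ * Real.cos θ| ≤ 1)
  have u6 := abs_le.1 (by simpa using abs_sin_pow_mul_cos_pow_le θ 1 2 : |Real.sin θ * Real.cos θ ^ 2| ≤ 1)
  have u7 := abs_le.1 (by simpa using abs_sin_pow_mul_cos_pow_le θ 1 3 : |Real.sin θ * Real.cos θ ^ 3| ≤ 1)
  have u8 := abs_le.1 (by simpa using abs_sin_pow_mul_cos_pow_le θ 2 0 : |Real.sin θ ^ 2| ≤ 1)
  have u9 := abs_le.1 (by simpa using abs_sin_pow_mul_cos_pow_le θ 2 1 : |Real.sin θ ^ 2 * Real.cos θ| ≤ 1)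
  have u10 := abs_le.1 (by simpa using abs_sin_pow_mul_cos_pow_le θ 2 2 : |Real.sin θ ^ 2 * Real.cos θ ^ 2| ≤ 1)
  have u11 := abs_le.1 (by simpa using abs_sin_pow_mul_cos_pow_le θ 3 0 : |Real.sin θ ^ 3| ≤ 1)
  have u12 := abs_le.1 (by simpa using abs_sin_pow_mul_cos_pow_le θ 3 1 : |Real.sin θ ^ 3 * Real.cos θ| ≤ 1)
  have u13 := abs_le.1 (by simpa using abs_sin_pow_mul_cos_pow_le θ 3 2 : |Real.sin θ ^ 3 * Real.cos θ ^ 2| ≤ 1)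
  have u14 := abs_le.1 (by simpa using abs_sin_pow_mul_cos_pow_le θ 4 0 : |Real.sin θ ^ 4| ≤ 1)
  have u15 := abs_le.1 (by simpa using abs_sin_pow_mul_cos_pow_le θ 4 1 : |Real.sin θ ^ 4 * Real.cos θ| ≤ 1)
  have u16 := abs_le.1 (by simpa using abs_sin_pow_mul_cos_pow_le θ 5 0 : |Real.sin θ ^ 5| ≤ 1)
  have u17 := abs_le.1 (by simpa using abs_sin_pow_mul_cos_pow_le θ 5 1 : |Real.sin θ ^ 5 * Real.cos θ| ≤ 1)
  unfold m2
  linarith [u1.1, u1.2, u2.1, u2.2, u3.1, u3.2, u4.1, u4.2, u5.1, u5.2, u6.1, u6.2, u7.1, u7.2, u8.1, u8.2, u9.1, u9.2, u10.1, u10.2, u11.1, u11.2, u12.1, u12.2, u13.1, u13.2, u14.1, u14.2, u15.1, u15.2, u16.1, u16.2, u17.1, u17.2]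

/-- `m3 ≤ 205424/3125` (sum of the absolute values of its coefficients). [instance data] -/
theorem m3_le (θ : ℝ) : m3 θ ≤ (205424 / 3125 : ℝ) := by
  have u0 := abs_le.1 (by simpa using abs_sin_pow_mul_cos_pow_le θ 0 1 : |Real.cos θ| ≤ 1)
  have u1 := abs_le.1 (by simpa using abs_sin_pow_mul_cos_pow_le θ 0 2 : |Real.cos θ ^ 2| ≤ 1)
  have u2 := abs_le.1 (by simpa using abs_sin_pow_mul_cos_pow_le θ 0 3 : |Real.cos θ ^ 3| ≤ 1)
  have u3 := abs_le.1 (by simpa using abs_sin_pow_mul_cos_pow_le θ 1 0 : |Real.sin θ| ≤ 1)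
  have u4 := abs_le.1 (by simpa using abs_sin_pow_mul_cos_pow_le θ 1 1 : |Real.sin θ * Real.cos θ| ≤ 1)
  have u5 := abs_le.1 (by simpa using abs_sin_pow_mul_cos_pow_le θ 1 2 : |Real.sin θ * Real.cos θ ^ 2| ≤ 1)
  have u6 := abs_le.1 (by simpa using abs_sin_pow_mul_cos_pow_le θ 2 0 : |Real.sin θ ^ 2| ≤ 1)
  have u7 := abs_le.1 (by simpa using abs_sin_pow_mul_cos_pow_le θ 2 1 : |Real.sin θ ^ 2 * Real.cos θ| ≤ 1)
  have u8 := abs_le.1 (by simpa using abs_sin_pow_mul_cos_pow_le θ 2 2 : |Real.sin θ ^ 2 * Real.cos θ ^ 2| ≤ 1)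
  have u9 := abs_le.1 (by simpa using abs_sin_pow_mul_cos_pow_le θ 3 0 : |Real.sin θ ^ 3| ≤ 1)
  have u10 := abs_le.1 (by simpa using abs_sin_pow_mul_cos_pow_le θ 3 1 : |Real.sin θ ^ 3 * Real.cos θ| ≤ 1)
  have u11 := abs_le.1 (by simpa using abs_sin_pow_mul_cos_pow_le θ 4 0 : |Real.sin θ ^ 4| ≤ 1)
  have u12 := abs_le.1 (by simpa using abs_sin_pow_mul_cos_pow_le θ 4 1 : |Real.sin θ ^ 4 * Real.cos θ| ≤ 1)
  unfold m3
  linarith [u0.1, u0.2, u1.1, u1.2, u2.1, u2.2, u3.1, u3.2, u4.1, u4.2, u5.1, u5.2, u6.1, u6.2, u7.1, u7.2, u8.1, u8.2, u9.1, u9.2, u10.1, u10.2, u11.1, u11.2, u12.1, u12.2]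

/-- `m4 ≤ 27753/625` (sum of the absolute values of its coefficients). [instance data] -/
theorem m4_le (θ : ℝ) : m4 θ ≤ (27753 / 625 : ℝ) := by
  have u1 := abs_le.1 (by simpa using abs_sin_pow_mul_cos_pow_le θ 0 1 : |Real.cos θ| ≤ 1)
  have u2 := abs_le.1 (by simpa using abs_sin_pow_mul_cos_pow_le θ 1 0 : |Real.sin θ| ≤ 1)
  have u3 := abs_le.1 (by simpa using abs_sin_pow_mul_cos_pow_le θ 1 1 : |Real.sin θ * Real.cos θ| ≤ 1)
  have u4 := abs_le.1 (by simpa using abs_sin_pow_mul_cos_pow_le θ 1 2 : |Real.sin θ * Real.cos θ ^ 2| ≤ 1)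
  have u5 := abs_le.1 (by simpa using abs_sin_pow_mul_cos_pow_le θ 2 0 : |Real.sin θ ^ 2| ≤ 1)
  have u6 := abs_le.1 (by simpa using abs_sin_pow_mul_cos_pow_le θ 2 1 : |Real.sin θ ^ 2 * Real.cos θ| ≤ 1)
  have u7 := abs_le.1 (by simpa using abs_sin_pow_mul_cos_pow_le θ 3 0 : |Real.sin θ ^ 3| ≤ 1)
  have u8 := abs_le.1 (by simpa using abs_sin_pow_mul_cos_pow_le θ 3 1 : |Real.sin θ ^ 3 * Real.cos θ| ≤ 1)
  unfold m4
  linarith [u1.1, u1.2, u2.1, u2.2, u3.1, u3.2, u4.1, u4.2, u5.1, u5.2, u6.1, u6.2, u7.1, u7.2, u8.1, u8.2]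

/-- `m5 ≤ 1259/125` (sum of the absolute values of its coefficients). [instance data] -/
theorem m5_le (θ : ℝ) : m5 θ ≤ (1259 / 125 : ℝ) := by
  have u1 := abs_le.1 (by simpa using abs_sin_pow_mul_cos_pow_le θ 0 1 : |Real.cos θ| ≤ 1)
  have u2 := abs_le.1 (by simpa using abs_sin_pow_mul_cos_pow_le θ 0 2 : |Real.cos θ ^ 2| ≤ 1)
  have u3 := abs_le.1 (by simpa using abs_sin_pow_mul_cos_pow_le θ 1 0 : |Real.sin θ| ≤ 1)
  have u4 := abs_le.1 (by simpa using abs_sin_pow_mul_cos_pow_le θ 1 1 : |Real.sin θ * Real.cos θ| ≤ 1)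
  have u5 := abs_le.1 (by simpa using abs_sin_pow_mul_cos_pow_le θ 2 0 : |Real.sin θ ^ 2| ≤ 1)
  have u6 := abs_le.1 (by simpa using abs_sin_pow_mul_cos_pow_le θ 2 1 : |Real.sin θ ^ 2 * Real.cos θ| ≤ 1)
  unfold m5
  linarith [u1.1, u1.2, u2.1, u2.2, u3.1, u3.2, u4.1, u4.2, u5.1, u5.2, u6.1, u6.2]

/-- **THE TAIL SIGN**: `E₂(θ) ≤ 0` for every `θ ≥ 10`. [instance data] -/
theorem E2_nonpos {θ : ℝ} (hθ : 10 ≤ θ) : E2 θ ≤ 0 := by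
  have hθ0 : 0 < θ := by linarith
  have hid := tail_identity hθ0.ne'
  have b0 := m0_le θ; have b1 := m1_le θ; have b2 := m2_le θ; have b3 := m3_le θ; have b4 := m4_le θ; have b5 := m5_le θ
  have p1 : 0 ≤ θ := hθ0.le
  have p2 : 0 ≤ θ ^ 2 := by positivity
  have p3 : 0 ≤ θ ^ 3 := by positivity
  have p4 : 0 ≤ θ ^ 4 := by positivity
  have p5 : 0 < θ ^ 5 := by positivity
  -- θ^j ≤ θ^5 / 10^(5-j)
  have q4 : θ ^ 4 * 10 ≤ θ ^ 5 := by nlinarith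
  have q3 : θ ^ 3 * 100 ≤ θ ^ 5 := by nlinarith
  have q2 : θ ^ 2 * 1000 ≤ θ ^ 5 := by nlinarith
  have q1 : θ * 10000 ≤ θ ^ 5 := by nlinarith
  have q0 : (100000 : ℝ) ≤ θ ^ 5 := by nlinarith
  have q6 : θ ^ 5 * 10 ≤ θ ^ 6 := by nlinarith
  have hup : θ ^ 5 * E2 θ ≤ 0 := by
    rw [hid]
    nlinarith [mul_le_mul_of_nonneg_right b5 p5.le, mul_le_mul_of_nonneg_right b4 p4,
      mul_le_mul_of_nonneg_right b3 p3, mul_le_mul_of_nonneg_right b2 p2, mul_le_mul_of_nonneg_right b1 p1]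
  have h2 : θ ^ 5 * E2 θ ≤ θ ^ 5 * 0 := by rw [mul_zero]; exact hup
  exact le_of_mul_le_mul_left h2 p5

/-- `f₂ > 0` for `θ ≥ 10` (indeed `f₂ ≥ 1 − 1/10 − (2/5)/100 − (52/25)/1000`). [instance data] -/
theorem f2_pos {θ : ℝ} (hθ : 10 ≤ θ) : 0 < f2 θ := by
  have hθ0 : 0 < θ := by linarith
  have hS := Real.abs_sin_le_one θ
  have hC := Real.abs_cos_le_one θ
  have hS' := abs_le.1 hS
  have hC' := abs_le.1 hC
  have e : f2 θ = (θ ^ 3 - θ ^ 2 + 2 / 5 * Real.cos θ * θ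
      + (8 / 5 * Real.sin θ + 2 / 25 * Real.sin θ * Real.cos θ - 2 / 5 * Real.cos θ)) / θ ^ 3 := by
    unfold f2; field_simp
  rw [e]
  apply div_pos _ (by positivity)
  nlinarith [mul_nonneg (mul_nonneg hθ0.le hθ0.le) (by linarith : (0:ℝ) ≤ θ - 10), hθ0]

/-! ### §3 The Riccati field of the tail -/

/-- `w₂ = f₂′/f₂ − ΛΛ′/p` (log-derivative of `u₂ = f₂·p^{-1/2}`). [instance data] -/
def w2 (θ : ℝ) : ℝ :=
  f2' θ / f2 θ - SAlpha.shearParam 1 (2 / 5) θ * SAlpha.localShear 1 (2 / 5) θ / SAlpha.bending 1 (2 / 5) θ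

/-- The derivative of `(1+Λ²)·w₂ = p f₂′/f₂ − ΛΛ′`:
`(p′ f₂′ + p f₂″)/f₂ − p f₂′²/f₂² − (Λ′² + (2/5)Λ sin θ)`, `p′ = 2ΛΛ′`. [instance data] -/
def pw2' (θ : ℝ) : ℝ :=
  ((2 * SAlpha.shearParam 1 (2 / 5) θ * SAlpha.localShear 1 (2 / 5) θ) * f2' θ
      + SAlpha.bending 1 (2 / 5) θ * f2'' θ) / f2 θ
    - SAlpha.bending 1 (2 / 5) θ * f2' θ ^ 2 / f2 θ ^ 2
    - (SAlpha.localShear 1 (2 / 5) θ ^ 2 + SAlpha.shearParam 1 (2 / 5) θ * (2 / 5 * Real.sin θ))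

/-- `(1+Λ²)·w₂` without the quotient by `1+Λ²`. [instance data] -/
theorem bending_mul_w2 (θ : ℝ) :
    SAlpha.bending 1 (2 / 5) θ * w2 θ
      = SAlpha.bending 1 (2 / 5) θ * f2' θ / f2 θ - SAlpha.shearParam 1 (2 / 5) θ * SAlpha.localShear 1 (2 / 5) θ := by
  have hp : SAlpha.bending 1 (2 / 5) θ ≠ 0 := (SAlpha.bending_pos 1 (2 / 5) θ).ne'
  unfold w2
  field_simp

/-- The derivative of `(1+Λ²)w₂` is `pw2'` (`θ ≠ 0`, `f₂ ≠ 0`). [instance data] -/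
theorem hasDerivAt_bending_mul_w2 {θ : ℝ} (hθ : θ ≠ 0) (hf : f2 θ ≠ 0) :
    HasDerivAt (fun θ => SAlpha.bending 1 (2 / 5) θ * w2 θ) (pw2' θ) θ := by
  have e : (fun θ => SAlpha.bending 1 (2 / 5) θ * w2 θ)
      = fun θ => SAlpha.bending 1 (2 / 5) θ * f2' θ / f2 θ
          - SAlpha.shearParam 1 (2 / 5) θ * SAlpha.localShear 1 (2 / 5) θ := funext bending_mul_w2
  rw [e]
  have hΛ : HasDerivAt (SAlpha.shearParam 1 (2 / 5)) (SAlpha.localShear 1 (2 / 5) θ) θ :=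
    SAlpha.hasDerivAt_shearParam 1 (2 / 5) θ
  have hΛ' : HasDerivAt (SAlpha.localShear 1 (2 / 5)) (2 / 5 * Real.sin θ) θ := by
    unfold SAlpha.localShear
    have h := (Real.hasDerivAt_cos θ).const_mul (2 / 5 : ℝ)
    have h2 := h.const_sub (1 : ℝ)
    refine h2.congr_deriv ?_
    ring
  have hp : HasDerivAt (SAlpha.bending 1 (2 / 5))
      (2 * SAlpha.shearParam 1 (2 / 5) θ * SAlpha.localShear 1 (2 / 5) θ) θ := by
    unfold SAlpha.bending
    have h := (hΛ.mul hΛ).const_add (1 : ℝ)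
    have e2 : (fun θ => 1 + SAlpha.shearParam 1 (2 / 5) θ ^ 2)
        = fun θ => 1 + SAlpha.shearParam 1 (2 / 5) θ * SAlpha.shearParam 1 (2 / 5) θ := by
      funext y; ring
    rw [e2]
    refine h.congr_deriv ?_
    ring
  have hnum := hp.mul (hasDerivAt_f2' hθ)
  have hq := hnum.div (hasDerivAt_f2 hθ) hf
  have h := hq.sub (hΛ.mul hΛ')
  refine h.congr_deriv ?_
  unfold pw2'
  norm_num only [Pi.add_apply, Pi.sub_apply, Pi.mul_apply, Pi.div_apply, Pi.neg_apply]
  field_simp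

/-- THE RICCATI RESIDUAL OF THE TAIL IS `E₂/(p f₂)` (pure algebra; `f₂ ≠ 0`). [instance data] -/
theorem riccati_tail_eq {θ : ℝ} (hf : f2 θ ≠ 0) :
    SAlphaRiccati.riccati 1 (2 / 5) w2 pw2' θ = E2 θ / (SAlpha.bending 1 (2 / 5) θ * f2 θ) := by
  have hp : SAlpha.bending 1 (2 / 5) θ ≠ 0 := (SAlpha.bending_pos 1 (2 / 5) θ).ne'
  unfold SAlphaRiccati.riccati w2 pw2' E2 SAlpha.drive
  unfold SAlpha.bending at hp ⊢
  field_simp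
  unfold SAlpha.localShear SAlpha.shearParam
  ring

/-- **`Ric(w₂) ≤ 0` on `[10, ∞)`.** [instance data] -/
theorem riccati_tail_nonpos {θ : ℝ} (hθ : 10 ≤ θ) : SAlphaRiccati.riccati 1 (2 / 5) w2 pw2' θ ≤ 0 := by
  have hθ0 : 0 < θ := by linarith
  have hf := f2_pos hθ
  have hp := SAlpha.bending_pos 1 (2 / 5) θ
  rw [riccati_tail_eq hf.ne']
  exact div_nonpos_iff.2 (Or.inr ⟨E2_nonpos hθ, by positivity⟩)

end SAlphaStableTail

end Summit.Ventures.FusionMHD.Models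

end
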